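/-
Copyright (c) 2026 the pub-hodgecm-mathlib formalisation cell (harness21).  Prover seat hodgecm-mathlib-LH10-p01 (g10): road «M6 ∕ F3 TOT-Λ BY OVER-ORDERS»
(LEAD T14-66; dealer LH4-plan (g8) WORD #77; F3-5 pen LH7-p04 (g11) 23:40:00Z «(c4) YES please»), carve (c4) «INTEGRAL READING»: the over-orders `O ≤ E × K` of
★ F3-2b's partition are read inside the integral product `𝒪_E × 𝒪_K` where ★ F3-1a ∕ (c3) ∕ ★ F3-3 live, and their unit indices agree; 2026-09-02.
-/
import Literature.NumberTheory.Automorphic.TypeTwoCommutantBridge   -- ★ (D3) p846662: the frame `(jO, hjO, σO σ hσO, σKO σK hσKO, hσv hσKv)` and `relIndex_units_map_prod_eq` (the case `R = 𝒪_E[(u, λ)]`); brings ★ `mem_range_units_map_subtype_iff`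
import HarnessLib

/-!
# Over-orders in `E × K` read in `𝒪_E × 𝒪_K`: integrality of multipliers, the subring dictionary, and the unit index

Topic `NumberTheory/Automorphic`; namespace `Literature.NumberTheory.Automorphic`.  THEOREMS ONLY (no definition, no instance, no notation, no named fact, no `sorry`).
Cell `pub/hodgecm-mathlib` (D-0151), crux H413 = `stmt-HodgeConjecture-24833`; road M6 → F3 «TOT-Λ by over-orders».  ★ F3-2b partitions the self-dual `τ`-stable lattices
by their multiplier rings `O(Λ) = {x ∈ E × K | φ(x)Λ ⊆ Λ}`, subrings of `B = E × K`; ★ F3-1a ∕ (c3) `GluedOverOrdersExhaustion` ∕ ★ F3-3 classify and count over-orders as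
subrings of the INTEGRAL product `𝒪_E × O₁` (`O₁ = 𝒪_K`).  This file is the dictionary between the two (two valued fields `E`, `K`, an `E`-algebra structure on `K`, and an
integral structure map `jO : 𝒪_E → 𝒪_K` over `algebraMap E K`, the frame of ★ (D3) `TypeTwoCommutantBridge` §Order):

* §1 INTEGRALITY: an `x ∈ E × K` multiplying a finitely generated `𝒪_E`-submodule `Λ′ ≤ E × K` with non-zero projections into itself has `x.1 ∈ 𝒪_E`, `x.2 ∈ 𝒪_K`
  (Cayley–Hamilton: Mathlib `isIntegral_of_smul_mem_submodule`, and valuation rings are integrally closed, `Valuation.Integers.mem_of_integral`);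
  the lattice-side reading `mem_integer_of_map_toLin'_le` through an orbit isomorphism `Ψ b = φ(b)·w₀` (★ F3-2b `exists_linearEquiv_eq_mulVec`), and its
  `Λ = Λ(u)` (`u ∈ GL₃`) specialisation — so `O(Λ) ⊆ 𝒪_E × 𝒪_K` for every full lattice.
* §2 THE SUBRING DICTIONARY along `incl = (coe, coe) : 𝒪_E × 𝒪_K → E × K`: `range incl = {x | x.1 ∈ 𝒪_E ∧ x.2 ∈ 𝒪_K}`, a subring `O ⊆ range incl` is `incl(incl⁻¹ O)`,
  and `incl⁻¹ O` contains the diagonal `(y, jO y)` when `O` contains the scalars — the hypotheses `hδ` of (c3) and `hO` of ★ F3-2a ∕ F3-2b matched.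
* §3 THE UNIT INDEX `[C_B : O_B^×] = [C : O^×]` for ANY subring `O ≤ 𝒪_E × 𝒪_K` (`O_B = incl O`, `C = {c | c c⋆ ∈ O^×}`): ★ (D3) `relIndex_units_map_prod_eq` verbatim with the
  monogenic order replaced by a general subring (its proof never used monogenicity) — ★ F3-2a's count `[C_O : O^×]` in `(E × K)ˣ` equals ★ F3-3's integral index.

References: [Jacobowitz1962] R. Jacobowitz, *Hermitian forms over local fields*, Amer. J. Math. 84 (1962), §7 (multiplier orders; lattices of an order as a units-torsor);
[Neukirch1999] J. Neukirch, *Algebraic Number Theory*, Grundlehren 322 (1999), Ch. I §12 (orders are contained in the maximal order; conductors); [AtiyahMacdonald1969]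
M. Atiyah, I. Macdonald, *Introduction to Commutative Algebra* (1969), Prop. 2.4 + Prop. 5.1 (the determinant trick: stabilisers of finitely generated faithful modules are
integral), Prop. 5.18 (iii) (valuation rings are integrally closed); [Rogawski1990] J. Rogawski, *Automorphic representations of unitary groups in three variables*, §4.9 Lemma 4.9.3
p. 56 (the unit-index count).
-/

set_option autoImplicit false

noncomputable section

open scoped ValuativeRel Matrix
open ValuativeRel Matrix

namespace Literature.NumberTheory.Automorphic

section Integrality

variable {E : Type*} [Field E] [ValuativeRel E] {K : Type*} [Field K] [ValuativeRel K] [Algebra E K]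

/-! ## §1 Multipliers of a full lattice are integral -/

omit [ValuativeRel K] in
/-- **THE `E`-COORDINATE OF A MULTIPLIER IS INTEGRAL**: if `x·Λ′ ⊆ Λ′` for a finitely generated `𝒪_E`-submodule `Λ′ ≤ E × K` with SOME non-zero first coordinate, then
`x.1 ∈ 𝒪_E` — `x.1` stabilises the non-zero finitely generated `𝒪_E`-module `pr₁ Λ′ ≤ E`, so it is integral over `𝒪_E` (determinant trick), and `𝒪_E` is integrally closed
in `E`. [cite: AtiyahMacdonald1969, Prop. 2.4, Prop. 5.1] [cite: Neukirch1999, Ch. I §12] -/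
theorem fst_mem_integer_of_mul_mem (Λ' : Submodule 𝒪[E] (E × K)) (hfg : Λ'.FG) (h1 : ∃ m ∈ Λ', m.1 ≠ 0) (x : E × K)
    (hx : ∀ m ∈ Λ', x * m ∈ Λ') : x.1 ∈ 𝒪[E] := by
  set N : Submodule 𝒪[E] E := Λ'.map (LinearMap.fst 𝒪[E] E K) with hN
  have hNbot : N ≠ ⊥ := by
    obtain ⟨m, hm, hm0⟩ := h1
    intro h
    have : m.1 ∈ N := ⟨m, hm, rfl⟩
    rw [h, Submodule.mem_bot] at this
    exact hm0 this
  have hint : IsIntegral 𝒪[E] x.1 := by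
    refine isIntegral_of_smul_mem_submodule N hNbot (hfg.map _) x.1 ?_
    rintro _ ⟨m, hm, rfl⟩
    exact ⟨x * m, hx m hm, by simp [smul_eq_mul]⟩
  exact Valuation.Integers.mem_of_integral (Valuation.integer.integers (valuation E)) hint

omit [ValuativeRel E] in
/-- Spans over `𝒪_E` lie inside spans over `𝒪_K` (the scalars act through `algebraMap E K`, which maps `𝒪_E` into `𝒪_K`). [cite: Neukirch1999, Ch. I §12] -/
theorem span_integer_subset_span_integer {S₀ : Subring E} (hOK : ∀ r : S₀, algebraMap E K (r : E) ∈ 𝒪[K]) (S : Set K) :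
    (Submodule.span S₀ S : Set K) ⊆ (Submodule.span 𝒪[K] S : Set K) := by
  intro y hy
  induction hy using Submodule.span_induction with
  | mem z hz => exact Submodule.subset_span hz
  | zero => exact Submodule.zero_mem _
  | add z z' _ _ hz hz' => exact Submodule.add_mem _ hz hz'
  | smul r z _ hz =>
    have h : (r • z : K) = (⟨algebraMap E K (r : E), hOK r⟩ : 𝒪[K]) • z := by
      rw [Subring.smul_def, Algebra.smul_def]; rfl
    rw [h]
    exact Submodule.smul_mem _ _ hz

/-- **THE `K`-COORDINATE OF A MULTIPLIER IS INTEGRAL**: if `x·Λ′ ⊆ Λ′` for a finitely generated `𝒪_E`-submodule `Λ′ ≤ E × K` with SOME non-zero second coordinate (and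
`algebraMap E K` maps `𝒪_E` into `𝒪_K`), then `x.2 ∈ 𝒪_K`: `x.2` stabilises the `𝒪_K`-span of `pr₂` of a generating set, a non-zero finitely generated `𝒪_K`-module, so it is
integral over `𝒪_K`, which is integrally closed in `K`. [cite: AtiyahMacdonald1969, Prop. 2.4, Prop. 5.1] [cite: Neukirch1999, Ch. I §12] -/
theorem snd_mem_integer_of_mul_mem (hOK : ∀ r : 𝒪[E], algebraMap E K (r : E) ∈ 𝒪[K]) (Λ' : Submodule 𝒪[E] (E × K)) (hfg : Λ'.FG)
    (h2 : ∃ m ∈ Λ', m.2 ≠ 0) (x : E × K) (hx : ∀ m ∈ Λ', x * m ∈ Λ') : x.2 ∈ 𝒪[K] := by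
  classical
  obtain ⟨G, hG⟩ := hfg
  set N : Submodule 𝒪[K] K := Submodule.span 𝒪[K] (Prod.snd '' (G : Set (E × K))) with hN
  -- `pr₂ Λ′ ⊆ N`
  have hsub : ∀ m ∈ Λ', m.2 ∈ N := by
    intro m hm
    have h1 : m.2 ∈ (Λ'.map (LinearMap.snd 𝒪[E] E K) : Set K) := ⟨m, hm, rfl⟩
    rw [← hG, Submodule.map_span] at h1
    have h2 : ((LinearMap.snd 𝒪[E] E K) '' (G : Set (E × K))) = Prod.snd '' (G : Set (E × K)) := rfl
    rw [h2] at h1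
    exact span_integer_subset_span_integer hOK _ h1
  have hNbot : N ≠ ⊥ := by
    obtain ⟨m, hm, hm0⟩ := h2
    intro h
    have := hsub m hm
    rw [h, Submodule.mem_bot] at this
    exact hm0 this
  have hNfg : N.FG := Submodule.fg_span ((G.finite_toSet).image _)
  have hGΛ : ∀ g ∈ (G : Set (E × K)), g ∈ Λ' := fun g hg => by rw [← hG]; exact Submodule.subset_span hg
  have hstab : ∀ n ∈ N, x.2 • n ∈ N := by
    have hle : N.map (LinearMap.mulLeft 𝒪[K] x.2) ≤ N := by
      rw [hN, Submodule.map_span_le]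
      rintro _ ⟨g, hg, rfl⟩
      have h := hsub (x * g) (hx g (hGΛ g hg))
      exact h
    intro n hn
    exact hle ⟨n, hn, rfl⟩
  have hint : IsIntegral 𝒪[K] x.2 := isIntegral_of_smul_mem_submodule N hNbot hNfg x.2 hstab
  exact Valuation.Integers.mem_of_integral (Valuation.integer.integers (valuation K)) hint

/-- **MULTIPLIERS OF A FULL LATTICE ARE INTEGRAL (lattice currency).**  `φ : E × K → M_n(E)` an `E`-algebra map with an orbit isomorphism `Ψ : E × K ≅ Eⁿ`, `Ψ b = φ(b)·w₀`
(★ F3-2b `exists_linearEquiv_eq_mulVec`); `Λ ≤ Eⁿ` a finitely generated `𝒪_E`-lattice spanning `Eⁿ` over `E`.  If `φ(x)·Λ ⊆ Λ` then `x.1 ∈ 𝒪_E` and `x.2 ∈ 𝒪_K`: pull `Λ`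
back to `Λ′ = Ψ⁻¹Λ ≤ E × K` (`x·Λ′ ⊆ Λ′`, both projections non-zero by fullness) and apply §1.  Hence the multiplier ring `O(Λ)` of ★ F3-2b lies in `𝒪_E × 𝒪_K`.
[cite: Jacobowitz1962, §7] [cite: Neukirch1999, Ch. I §12] [cite: AtiyahMacdonald1969, Prop. 5.1] -/
theorem mem_integer_of_map_toLin'_le (hOK : ∀ r : 𝒪[E], algebraMap E K (r : E) ∈ 𝒪[K]) {n : ℕ}
    (φ : (E × K) →ₐ[E] Matrix (Fin n) (Fin n) E) (Ψ : (E × K) ≃ₗ[E] (Fin n → E)) {w₀ : Fin n → E} (hΨ : ∀ b, Ψ b = φ b *ᵥ w₀)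
    (Λ : Submodule 𝒪[E] (Fin n → E)) (hfg : Λ.FG) (hfull : Submodule.span E (Λ : Set (Fin n → E)) = ⊤) (x : E × K)
    (hx : Λ.map ((Matrix.toLin' (φ x)).restrictScalars 𝒪[E]) ≤ Λ) : x.1 ∈ 𝒪[E] ∧ x.2 ∈ 𝒪[K] := by
  have hΨmul : ∀ b m : E × K, Ψ (b * m) = φ b *ᵥ Ψ m := fun b m => by rw [hΨ, hΨ, map_mul, Matrix.mulVec_mulVec]
  set Λ' : Submodule 𝒪[E] (E × K) := Λ.comap ((Ψ.restrictScalars 𝒪[E] : (E × K) ≃ₗ[𝒪[E]] (Fin n → E)) : (E × K) →ₗ[𝒪[E]] (Fin n → E))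
    with hΛ'
  have hmem : ∀ m, m ∈ Λ' ↔ Ψ m ∈ Λ := fun m => Iff.rfl
  have hfg' : Λ'.FG := by
    have h : Λ' = Λ.map ((Ψ.restrictScalars 𝒪[E]).symm : (Fin n → E) →ₗ[𝒪[E]] (E × K)) := by
      rw [Submodule.map_equiv_eq_comap_symm, LinearEquiv.symm_symm]
    rw [h]; exact hfg.map _
  have hx' : ∀ m ∈ Λ', x * m ∈ Λ' := fun m hm => by
    rw [hmem, hΨmul]
    exact hx ⟨Ψ m, (hmem m).1 hm, rfl⟩
  -- fullness: `Λ′` spans `E × K` over `E`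
  have hfull' : Submodule.span E (Λ' : Set (E × K)) = ⊤ := by
    rw [eq_top_iff]
    intro m _
    have hm : Ψ m ∈ Submodule.span E (Λ : Set (Fin n → E)) := by rw [hfull]; trivial
    have h2 : (Submodule.span E (Λ : Set (Fin n → E))).map (Ψ.symm : (Fin n → E) →ₗ[E] (E × K)) ≤ Submodule.span E (Λ' : Set (E × K)) := by
      rw [Submodule.map_span_le]
      intro y hy
      refine Submodule.subset_span ((hmem _).2 ?_)
      rw [LinearEquiv.coe_coe, LinearEquiv.apply_symm_apply]
      exact hy
    exact h2 ⟨Ψ m, hm, by rw [LinearEquiv.coe_coe, LinearEquiv.symm_apply_apply]⟩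
  have h1 : ∃ m ∈ Λ', m.1 ≠ 0 := by
    by_contra hall
    push Not at hall
    have hker : Submodule.span E (Λ' : Set (E × K)) ≤ LinearMap.ker (LinearMap.fst E E K) :=
      Submodule.span_le.2 fun m hm => hall m hm
    rw [hfull', top_le_iff, LinearMap.ker_eq_top] at hker
    exact (one_ne_zero : (1 : E) ≠ 0) (by simpa using LinearMap.congr_fun hker ((1, 0) : E × K))
  have h2 : ∃ m ∈ Λ', m.2 ≠ 0 := by
    by_contra hall
    push Not at hall
    have hker : Submodule.span E (Λ' : Set (E × K)) ≤ LinearMap.ker (LinearMap.snd E E K) :=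
      Submodule.span_le.2 fun m hm => hall m hm
    rw [hfull', top_le_iff, LinearMap.ker_eq_top] at hker
    exact (one_ne_zero : (1 : K) ≠ 0) (by simpa using LinearMap.congr_fun hker ((0, 1) : E × K))
  exact ⟨fst_mem_integer_of_mul_mem Λ' hfg' h1 x hx', snd_mem_integer_of_mul_mem hOK Λ' hfg' h2 x hx'⟩

/-- **The multiplier ring of `Λ(u)`, `u ∈ GL_n(E)`, lies in `𝒪_E × 𝒪_K`** (the lattices of ★ F3-2b: `Λ(u) = span 𝒪 (range uᵀ)` is finitely generated and full).
[cite: Jacobowitz1962, §7] [cite: Neukirch1999, Ch. I §12] -/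
theorem mem_integer_of_map_toLin'_le_span_range_transpose (hOK : ∀ r : 𝒪[E], algebraMap E K (r : E) ∈ 𝒪[K]) {n : ℕ}
    (φ : (E × K) →ₐ[E] Matrix (Fin n) (Fin n) E) (Ψ : (E × K) ≃ₗ[E] (Fin n → E)) {w₀ : Fin n → E} (hΨ : ∀ b, Ψ b = φ b *ᵥ w₀)
    (u : GL (Fin n) E) (x : E × K)
    (hx : (Submodule.span 𝒪[E] (Set.range ((u : Matrix (Fin n) (Fin n) E))ᵀ)).map ((Matrix.toLin' (φ x)).restrictScalars 𝒪[E]) ≤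
      Submodule.span 𝒪[E] (Set.range ((u : Matrix (Fin n) (Fin n) E))ᵀ)) : x.1 ∈ 𝒪[E] ∧ x.2 ∈ 𝒪[K] := by
  refine mem_integer_of_map_toLin'_le hOK φ Ψ hΨ _ (Submodule.fg_span (Set.finite_range _)) ?_ x hx
  -- fullness: `span_E (span_𝒪 (cols u)) ⊇ span_E (cols u) = ⊤`
  rw [eq_top_iff]
  have hcols : Submodule.span E (Set.range ((u : Matrix (Fin n) (Fin n) E))ᵀ) = ⊤ := by
    rw [eq_top_iff]
    intro y _
    have hy : y = ∑ j, (((u⁻¹ : GL (Fin n) E) : Matrix (Fin n) (Fin n) E) *ᵥ y) j • ((u : Matrix (Fin n) (Fin n) E))ᵀ j := by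
      have h : (u : Matrix (Fin n) (Fin n) E) *ᵥ ((((u⁻¹ : GL (Fin n) E) : Matrix (Fin n) (Fin n) E)) *ᵥ y) = y := by
        rw [Matrix.mulVec_mulVec, ← Units.val_mul, mul_inv_cancel, Units.val_one, Matrix.one_mulVec]
      conv_lhs => rw [← h]
      ext i
      simp only [Matrix.mulVec, dotProduct, Finset.sum_apply, Pi.smul_apply, smul_eq_mul, Matrix.transpose_apply]
      exact Finset.sum_congr rfl fun j _ => mul_comm _ _
    rw [hy]
    exact Submodule.sum_mem _ fun j _ => Submodule.smul_mem _ _ (Submodule.subset_span ⟨j, rfl⟩)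
  rw [← hcols]
  exact Submodule.span_mono Submodule.subset_span

end Integrality

/-! ## §2 The subring dictionary along `incl : 𝒪_E × 𝒪_K → E × K` -/

section Dictionary

variable {E : Type*} [Field E] [ValuativeRel E] {K : Type*} [Field K] [ValuativeRel K] [Algebra E K]
  (jO : 𝒪[E] →+* 𝒪[K]) (hjO : ∀ x : 𝒪[E], ((jO x : 𝒪[K]) : K) = algebraMap E K x)

omit [Algebra E K] in
/-- `range incl = {x | x.1 ∈ 𝒪_E ∧ x.2 ∈ 𝒪_K}` for `incl = (coe, coe) : 𝒪_E × 𝒪_K → E × K`. [cite: Neukirch1999, Ch. I §12] -/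
theorem mem_range_prodMap_subtype_iff (x : E × K) :
    x ∈ Set.range (RingHom.prodMap (𝒪[E]).subtype (𝒪[K]).subtype) ↔ x.1 ∈ 𝒪[E] ∧ x.2 ∈ 𝒪[K] := by
  constructor
  · rintro ⟨⟨a, b⟩, rfl⟩; exact ⟨a.2, b.2⟩
  · rintro ⟨h1, h2⟩; exact ⟨(⟨x.1, h1⟩, ⟨x.2, h2⟩), Prod.ext rfl rfl⟩

omit [Algebra E K] in
/-- `incl` is injective. [cite: Neukirch1999, Ch. I §12] -/
theorem prodMap_integer_subtype_injective : Function.Injective (RingHom.prodMap (𝒪[E]).subtype (𝒪[K]).subtype) := by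
  rintro ⟨a, b⟩ ⟨a', b'⟩ h
  have h' : ((a : E), (b : K)) = ((a' : E), (b' : K)) := h
  rw [Prod.mk.injEq] at h'
  exact Prod.ext (Subtype.ext h'.1) (Subtype.ext h'.2)

omit [Algebra E K] in
/-- **A subring inside the maximal order is the image of its integral preimage**: `O ⊆ range incl ⇒ incl (incl⁻¹ O) = O`. [cite: Neukirch1999, Ch. I §12] -/
theorem map_comap_prodMap_subtype_eq (O : Subring (E × K)) (hO : (O : Set (E × K)) ⊆ Set.range (RingHom.prodMap (𝒪[E]).subtype (𝒪[K]).subtype)) :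
    (O.comap (RingHom.prodMap (𝒪[E]).subtype (𝒪[K]).subtype)).map (RingHom.prodMap (𝒪[E]).subtype (𝒪[K]).subtype) = O :=
  SetLike.coe_injective (by rw [Subring.coe_map, Subring.coe_comap, Set.image_preimage_eq_of_subset hO])

omit [Algebra E K] in
/-- Conversely `incl⁻¹ (incl S) = S` for every `S ≤ 𝒪_E × 𝒪_K` (`incl` injective). [cite: Neukirch1999, Ch. I §12] -/
theorem comap_map_prodMap_subtype_eq (S : Subring (𝒪[E] × 𝒪[K])) :
    (S.map (RingHom.prodMap (𝒪[E]).subtype (𝒪[K]).subtype)).comap (RingHom.prodMap (𝒪[E]).subtype (𝒪[K]).subtype) = S :=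
  SetLike.coe_injective (by rw [Subring.coe_comap, Subring.coe_map, Set.preimage_image_eq _ prodMap_integer_subtype_injective])

include hjO in
/-- **The integral preimage contains the diagonal**: if `O ≤ E × K` contains the scalars `algebraMap E (E × K) r`, `r ∈ 𝒪_E` (the `hO` of ★ F3-2a ∕ F3-2b), then `incl⁻¹ O`
contains every `(y, jO y)` (the `hδ` of (c3) `GluedOverOrdersExhaustion`). [cite: Neukirch1999, Ch. I §12] -/
theorem mk_mem_comap_prodMap_subtype (O : Subring (E × K)) (hO : ∀ r : 𝒪[E], algebraMap E (E × K) (r : E) ∈ O) (y : 𝒪[E]) :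
    ((y, jO y) : 𝒪[E] × 𝒪[K]) ∈ O.comap (RingHom.prodMap (𝒪[E]).subtype (𝒪[K]).subtype) := by
  rw [Subring.mem_comap]
  have h : RingHom.prodMap (𝒪[E]).subtype (𝒪[K]).subtype ((y, jO y) : 𝒪[E] × 𝒪[K]) = algebraMap E (E × K) (y : E) := by
    rw [Prod.algebraMap_apply, Algebra.algebraMap_self, RingHom.id_apply, ← hjO]; rfl
  rw [h]; exact hO y

/-- **The multiplier subring of a full lattice lies in the maximal order**: if `↑O = {x | φ(x)Λ(u) ⊆ Λ(u)}` (★ F3-2b (B1)) then `↑O ⊆ range incl` — so §2 and (c3) apply to it.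
[cite: Jacobowitz1962, §7] [cite: Neukirch1999, Ch. I §12] -/
theorem coe_subset_range_prodMap_subtype_of_coe_eq (hOK : ∀ r : 𝒪[E], algebraMap E K (r : E) ∈ 𝒪[K]) {n : ℕ}
    (φ : (E × K) →ₐ[E] Matrix (Fin n) (Fin n) E) (Ψ : (E × K) ≃ₗ[E] (Fin n → E)) {w₀ : Fin n → E} (hΨ : ∀ b, Ψ b = φ b *ᵥ w₀)
    (u : GL (Fin n) E) (O : Subring (E × K))
    (hOcoe : (O : Set (E × K)) = {x : E × K |
      (Submodule.span 𝒪[E] (Set.range ((u : Matrix (Fin n) (Fin n) E))ᵀ)).map ((Matrix.toLin' (φ x)).restrictScalars 𝒪[E]) ≤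
        Submodule.span 𝒪[E] (Set.range ((u : Matrix (Fin n) (Fin n) E))ᵀ)}) :
    (O : Set (E × K)) ⊆ Set.range (RingHom.prodMap (𝒪[E]).subtype (𝒪[K]).subtype) := by
  intro x hx
  rw [hOcoe] at hx
  exact (mem_range_prodMap_subtype_iff x).2 (mem_integer_of_map_toLin'_le_span_range_transpose hOK φ Ψ hΨ u x hx)

end Dictionary

/-! ## §3 The unit index of a general subring `O ≤ 𝒪_E × 𝒪_K` read in `E × K` -/

section Index

variable {E : Type*} [Field E] [ValuativeRel E] {K : Type*} [Field K] [ValuativeRel K]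
  (σO : 𝒪[E] →+* 𝒪[E]) (σ : E →+* E) (hσO : ∀ x : 𝒪[E], ((σO x : 𝒪[E]) : E) = σ x)
  (σKO : 𝒪[K] →+* 𝒪[K]) (σK : K →+* K) (hσKO : ∀ z : 𝒪[K], ((σKO z : 𝒪[K]) : K) = σK z)
  (hσv : ∀ x, valuation E (σ x) = valuation E x) (hσKv : ∀ z, valuation K (σK z) = valuation K z)

include hσO hσKO hσv hσKv in
/-- **TRANSPORT OF THE UNIT INDEX TO `E × K`, FOR ANY SUBRING `O ≤ 𝒪_E × 𝒪_K`.**  Along the injective `incl : 𝒪_E × 𝒪_K → E × K`, `O^× = (Units.map O.subtype).range` maps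
onto `O_B^× = (incl O).toSubmonoid.units` and `C = N⁻¹O^×` onto `C_B = N_B⁻¹O_B^×` (`N = id·⋆`, `⋆ = (σ, σ_K)`; a `c` with `c c⋆ ∈ O_B^×` has `|c| = 1` componentwise as
`|σ·| = |·|`), so **`[C_B : O_B^×] = [C : O^×]`**.  ★ (D3) `relIndex_units_map_prod_eq` is the case `O = 𝒪_E[(u, λ)]`; the proof is the same (Mathlib
`Subgroup.relIndex_map_map_of_injective`). [cite: Jacobowitz1962, §7] [cite: Rogawski1990, §4.9 Lemma 4.9.3 p. 56] -/
theorem relIndex_units_map_prodMap_eq (O : Subring (𝒪[E] × 𝒪[K])) :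
    ((O.map (RingHom.prodMap (𝒪[E]).subtype (𝒪[K]).subtype)).toSubmonoid.units).relIndex
      (((O.map (RingHom.prodMap (𝒪[E]).subtype (𝒪[K]).subtype)).toSubmonoid.units).comap
        (MonoidHom.id (E × K)ˣ * Units.map (RingHom.prodMap σ σK).toMonoidHom)) =
    (Units.map (O.subtype : O →* 𝒪[E] × 𝒪[K])).range.relIndex
      ((Units.map (O.subtype : O →* 𝒪[E] × 𝒪[K])).range.comap
        (MonoidHom.id (𝒪[E] × 𝒪[K])ˣ * Units.map (RingHom.prodMap σO σKO : 𝒪[E] × 𝒪[K] →* 𝒪[E] × 𝒪[K]))) := by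
  set R := O with hR
  set incl : 𝒪[E] × 𝒪[K] →+* E × K := RingHom.prodMap (𝒪[E]).subtype (𝒪[K]).subtype with hincl
  set V := (Units.map (R.subtype : R →* 𝒪[E] × 𝒪[K])).range with hV
  set VB := (R.map incl).toSubmonoid.units with hVB
  set N := MonoidHom.id (𝒪[E] × 𝒪[K])ˣ * Units.map (RingHom.prodMap σO σKO : 𝒪[E] × 𝒪[K] →* 𝒪[E] × 𝒪[K]) with hN
  set NB := MonoidHom.id (E × K)ˣ * Units.map (RingHom.prodMap σ σK).toMonoidHom with hNB
  set Φ : (𝒪[E] × 𝒪[K])ˣ →* (E × K)ˣ := Units.map (incl : 𝒪[E] × 𝒪[K] →* E × K) with hΦ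
  have hincl_inj : Function.Injective incl := by
    rintro ⟨a, b⟩ ⟨a', b'⟩ h
    have h' : ((a : E), (b : K)) = ((a' : E), (b' : K)) := h
    rw [Prod.mk.injEq] at h'
    exact Prod.ext (Subtype.ext h'.1) (Subtype.ext h'.2)
  have hΦinj : Function.Injective Φ := fun x y h => Units.ext (hincl_inj (congrArg Units.val h))
  -- naturality of the norm
  have hnat' : ∀ y : 𝒪[E] × 𝒪[K], incl (RingHom.prodMap σO σKO y) = RingHom.prodMap σ σK (incl y) := by
    rintro ⟨a, b⟩; exact Prod.ext (hσO a) (hσKO b)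
  have hnat : ∀ c : (𝒪[E] × 𝒪[K])ˣ, Φ (N c) = NB (Φ c) := by
    intro c
    apply Units.ext
    change incl ((c : 𝒪[E] × 𝒪[K]) * RingHom.prodMap σO σKO (c : 𝒪[E] × 𝒪[K])) = incl (c : 𝒪[E] × 𝒪[K]) * RingHom.prodMap σ σK (incl (c : 𝒪[E] × 𝒪[K]))
    rw [map_mul, hnat']
  -- membership in `R.map incl` pulls back to `R`
  have hmemR : ∀ x : 𝒪[E] × 𝒪[K], incl x ∈ R.map incl ↔ x ∈ R := by
    intro x
    rw [Subring.mem_map]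
    constructor
    · rintro ⟨y, hy, hyx⟩; rwa [← hincl_inj hyx]
    · intro hx; exact ⟨x, hx, rfl⟩
  -- (a) `V.map Φ = VB`
  have hVmap : V.map Φ = VB := by
    ext x
    rw [Subgroup.mem_map, hVB, Submonoid.mem_units_iff]
    constructor
    · rintro ⟨v, hv, rfl⟩
      rw [hV, mem_range_units_map_subtype_iff] at hv
      refine ⟨?_, ?_⟩
      · change incl (v : 𝒪[E] × 𝒪[K]) ∈ (R.map incl).toSubmonoid
        exact (hmemR _).2 hv.1
      · rw [← map_inv]
        change incl (↑v⁻¹ : 𝒪[E] × 𝒪[K]) ∈ (R.map incl).toSubmonoid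
        exact (hmemR _).2 hv.2
    · rintro ⟨h1, h2⟩
      obtain ⟨r, hr, hrx⟩ := Subring.mem_map.1 h1
      obtain ⟨r', hr', hr'x⟩ := Subring.mem_map.1 h2
      have hrr' : r * r' = 1 := hincl_inj (by rw [map_mul, hrx, hr'x, Units.mul_inv, map_one])
      have hr'r : r' * r = 1 := by rw [mul_comm]; exact hrr'
      refine ⟨⟨r, r', hrr', hr'r⟩, ?_, Units.ext hrx⟩
      rw [hV, mem_range_units_map_subtype_iff]
      exact ⟨hr, hr'⟩
  -- (b) `(V.comap N).map Φ = VB.comap NB`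
  have hCmap : (V.comap N).map Φ = VB.comap NB := by
    ext x
    rw [Subgroup.mem_map, Subgroup.mem_comap]
    constructor
    · rintro ⟨c, hc, rfl⟩
      rw [← hnat, ← hVmap]
      exact Subgroup.mem_map_of_mem Φ (Subgroup.mem_comap.1 hc)
    · intro hx
      rw [hVB, Submonoid.mem_units_iff] at hx
      obtain ⟨r, hr, hrx⟩ := Subring.mem_map.1 hx.1
      obtain ⟨r', hr', hr'x⟩ := Subring.mem_map.1 hx.2
      have hNBval : ((NB x : (E × K)ˣ) : E × K) = (x : E × K) * RingHom.prodMap σ σK (x : E × K) := by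
        rw [hNB, MonoidHom.mul_apply, Units.val_mul, MonoidHom.id_apply, Units.coe_map]; rfl
      obtain ⟨⟨a, z⟩, ⟨a', z'⟩, hxx', hx'x⟩ := x
      have hprod1 : a * σ a = (r.1 : E) ∧ z * σK z = (r.2 : K) := by
        have h := hrx; rw [hNBval] at h
        exact ⟨(congrArg Prod.fst h).symm, (congrArg Prod.snd h).symm⟩
      have hprod2 : (a * σ a) * (r'.1 : E) = 1 ∧ (z * σK z) * (r'.2 : K) = 1 := by
        have h := (NB ⟨(a, z), (a', z'), hxx', hx'x⟩).mul_inv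
        rw [hNBval, ← hr'x] at h
        exact ⟨congrArg Prod.fst h, congrArg Prod.snd h⟩
      have hva : valuation E a = 1 := by
        have h1 : valuation E (a * σ a) ≤ 1 := by rw [hprod1.1]; exact r.1.2
        have h2 : 1 ≤ valuation E (a * σ a) := by
          have := congrArg (valuation E) hprod2.1
          rw [map_mul, map_one] at this
          by_contra hlt
          push Not at hlt
          have hle : valuation E ((r'.1 : 𝒪[E]) : E) ≤ 1 := r'.1.2
          have : valuation E (a * σ a) * valuation E ((r'.1 : 𝒪[E]) : E) < 1 := mul_lt_one_of_lt_of_le hlt hle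
          exact absurd ‹valuation E (a * σ a) * _ = 1› this.ne
        have heq : valuation E (a * σ a) = 1 := le_antisymm h1 h2
        rw [map_mul, hσv, ← sq] at heq
        exact (pow_eq_one_iff.1 heq).resolve_right two_ne_zero
      have hvz : valuation K z = 1 := by
        have h1 : valuation K (z * σK z) ≤ 1 := by rw [hprod1.2]; exact r.2.2
        have h2 : 1 ≤ valuation K (z * σK z) := by
          have := congrArg (valuation K) hprod2.2
          rw [map_mul, map_one] at this
          by_contra hlt
          push Not at hlt
          have hle : valuation K ((r'.2 : 𝒪[K]) : K) ≤ 1 := r'.2.2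
          have : valuation K (z * σK z) * valuation K ((r'.2 : 𝒪[K]) : K) < 1 := mul_lt_one_of_lt_of_le hlt hle
          exact absurd ‹valuation K (z * σK z) * _ = 1› this.ne
        have heq : valuation K (z * σK z) = 1 := le_antisymm h1 h2
        rw [map_mul, hσKv, ← sq] at heq
        exact (pow_eq_one_iff.1 heq).resolve_right two_ne_zero
      have hva' : valuation E a' = 1 := by
        have h := congrArg (fun p : E × K => valuation E p.1) hxx'
        simp only [Prod.fst_mul, Prod.fst_one, map_mul, map_one, hva, one_mul] at h
        exact h
      have hvz' : valuation K z' = 1 := by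
        have h := congrArg (fun p : E × K => valuation K p.2) hxx'
        simp only [Prod.snd_mul, Prod.snd_one, map_mul, map_one, hvz, one_mul] at h
        exact h
      -- the integral preimage
      set c : (𝒪[E] × 𝒪[K])ˣ :=
        ⟨(⟨a, (Valuation.mem_integer_iff _ _).2 hva.le⟩, ⟨z, (Valuation.mem_integer_iff _ _).2 hvz.le⟩),
         (⟨a', (Valuation.mem_integer_iff _ _).2 hva'.le⟩, ⟨z', (Valuation.mem_integer_iff _ _).2 hvz'.le⟩),
         hincl_inj (by rw [map_mul, map_one]; exact hxx'), hincl_inj (by rw [map_mul, map_one]; exact hx'x)⟩ with hc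
      have hΦc : Φ c = ⟨(a, z), (a', z'), hxx', hx'x⟩ := Units.ext rfl
      refine ⟨c, ?_, hΦc⟩
      rw [Subgroup.mem_comap]
      have hmem : Φ (N c) ∈ V.map Φ := by
        rw [hnat, hΦc, hVmap, hVB, Submonoid.mem_units_iff]; exact hx
      obtain ⟨c', hc', hcc'⟩ := Subgroup.mem_map.1 hmem
      rwa [← hΦinj hcc']
  rw [← hCmap, ← hVmap]
  exact Subgroup.relIndex_map_map_of_injective _ _ hΦinj

end Index

end Literature.NumberTheory.Automorphic

end
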